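import Summits.NavierStokesRegularity.NavierStokesRegularity.Theorems.ScenarioCensusGeneratorMeterScaling
import HarnessLib

/-!
# GENERATOR METER port, part 3/4: §F′ the frozen instant is TREE-DECIDED, two generators at one germ, the RANK LAW (`annihilator_rank_le_one`, `annihilator_in_open_cone`); §G the cells the profile
# dictionary does NOT decide (typed OPEN: expander slice, travelling instant)

Re-homed for the scenario census (typer seat ns-census-typer-1 g10; the cells A2gnS / A2gn0 / A2gnP / A2gnTf / A2gn2 are MEMBERS OF RECORD «DECIDED IN KERNEL IN FILES» of row A2
(item 84: critic idea-crit-3 g10 PASS 12:19:42Z; ref PRE-CHECK ✓ §19.13; lead label Pineau–Vicol arXiv:2607.09619 Thm 1.9), A2gnE / A2gnT OPEN (typed); this port makes the decided cells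
TREE-decided): VERBATIM PORT of ns-idea-2 LINE g17-3 «generator-meter», `pub/ideators/ns-idea-2/lines/generator-meter/line-generator-meter.lean` sha16 71227eedda12bed6 (934 l.,
lean check rc 0, 0 sorry), split for the 400-line rule into `ScenarioCensusGeneratorMeter` (§A–§C) → `…GeneratorMeterScaling` (§D–§F) → `…GeneratorMeterRank` (§F′–§G) →
`…GeneratorMeterRows` (§I–§J + census KEYS).  Lean text VERBATIM in namespace `…Theorems.ScenarioCensus.GeneratorMeter` (the line's `…Lines.GeneratorMeter` re-homed); port
edits: the line's `local notation "E3"` is spelled as the reducible `abbrev E3` of every census file; `@[conjecture]` on the OPEN rows `Row_A2gnE`, `Row_A2gnT`; one-line docstrings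
added where missing (gate lint).  Statements untouched.

No census VALUE is moved here (row A2 stays OPEN-WITH-LINE; the members become TREE-decided by name); (L′) is NOT proved; no summit statement is proved by this file.
-/

-- the summit and its single problem share the name `NavierStokesRegularity` (D-0017 nested layout)
set_option linter.dupNamespace false

noncomputable section

open Set Function Filter Metric
open scoped Topology
open Literature.Analysis Literature.Analysis.FluidPDE
open Summit.NavierStokesRegularity.NavierStokesRegularity.Theorems

namespace Summit.NavierStokesRegularity.NavierStokesRegularity.Theorems.ScenarioCensus.GeneratorMeter

variable {C : ℝ} {u : ℝ → E3 → E3}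

/-! ## F′. The frozen instant is TREE-DECIDED; two generators at one germ; the RANK LAW -/

/-- **FROZEN INSTANT (tree, BY NAME).** The drift generator `(0, 0, τ)`, `τ ≠ 0`, reads `τ ∂ₜu`; if it
vanishes on a germ of one slice then (germ → slice) the clock mode `∂ₜu(t₁, ·)` vanishes on the whole slice,
and ONE steady slice kills a class element — the tree's proved support item `SteadySliceLiouville`
⟨stmt-NavierStokesRegularity-10572⟩ over the class (`clockLaw_eq_zero_of_steady_slice`; the germ form is the
tree's `openSetSteadyLiouville`, crux ClockCeiling).  Not a contribution of this line. -/
theorem eq_zero_of_genReading_frozen (hu : IsTypeIAncientMild C u) {τ t₁ : ℝ} (ht₁ : t₁ < 0) (hτ : τ ≠ 0)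
    {U : Set E3} (hU : IsOpen U) (hne : U.Nonempty) (h : ∀ x ∈ U, genReading 0 0 τ u t₁ x = 0) :
    ∀ t < 0, ∀ x, u t x = 0 := by
  refine clockLaw_eq_zero_of_steady_slice hu ht₁ fun x => ?_
  have h0 := genReading_eq_zero_of_germ hu ht₁ hU hne h x
  simp only [genReading, zero_smul, add_zero, map_zero, zero_add, mul_zero, zero_mul] at h0
  exact (smul_eq_zero.1 h0).resolve_left hτ

/-- Core of the two-generator law (the first generator has a scaling part). -/
theorem eq_zero_of_twoGenReadings_core (hu : IsTypeIAncientMild C u) {a₁ a₂ : E3} {σ₁ σ₂ τ₁ τ₂ t₁ : ℝ}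
    (ht₁ : t₁ < 0) (hσ₁ : σ₁ ≠ 0) {U : Set E3} (hU : IsOpen U) (hne : U.Nonempty)
    (h₁ : ∀ x ∈ U, genReading a₁ σ₁ τ₁ u t₁ x = 0) (h₂ : ∀ x ∈ U, genReading a₂ σ₂ τ₂ u t₁ x = 0)
    (hmin : σ₁ * τ₂ ≠ σ₂ * τ₁ ∨ σ₁ • a₂ ≠ σ₂ • a₁ ∨ τ₁ • a₂ ≠ τ₂ • a₁) :
    ∀ t < 0, ∀ x, u t x = 0 := by
  -- the drift `σ₁ g₂ − σ₂ g₁ = (b, 0, ρ)` annihilates the germ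
  set b : E3 := (-σ₂) • a₁ + σ₁ • a₂ with hb
  set ρ : ℝ := -σ₂ * τ₁ + σ₁ * τ₂ with hρ
  have hdrift : ∀ x ∈ U, genReading b 0 ρ u t₁ x = 0 := by
    intro x hx
    have := genReading_comb (-σ₂) σ₁ a₁ a₂ σ₁ σ₂ τ₁ τ₂ u t₁ x
    rw [h₁ x hx, h₂ x hx, smul_zero, smul_zero, add_zero] at this
    rw [hb, hρ, ← this]
    congr 1; ring
  -- `(b, ρ) ≠ (0, 0)` is exactly the non-proportionality `hmin`
  have hbr : b ≠ 0 ∨ ρ ≠ 0 := by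
    by_cases hb0 : b = 0
    swap
    · exact Or.inl hb0
    by_cases hρ0 : ρ = 0
    swap
    · exact Or.inr hρ0
    exfalso
    have ha₂ : a₂ = (σ₁⁻¹ * σ₂) • a₁ := by
      have : σ₁ • a₂ = σ₂ • a₁ := by
        have := hb0; rw [hb] at this
        rwa [neg_smul, neg_add_eq_zero, eq_comm] at this
      calc a₂ = σ₁⁻¹ • (σ₁ • a₂) := by rw [inv_smul_smul₀ hσ₁]
        _ = (σ₁⁻¹ * σ₂) • a₁ := by rw [this, smul_smul]
    have hτ₂ : τ₂ = σ₁⁻¹ * σ₂ * τ₁ := by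
      have : σ₁ * τ₂ = σ₂ * τ₁ := by rw [hρ] at hρ0; linarith
      field_simp; linarith
    rcases hmin with h | h | h
    · exact h (by rw [hτ₂]; field_simp)
    · exact h (by rw [ha₂, smul_smul, mul_inv_cancel_left₀ hσ₁])
    · exact h (by rw [ha₂, hτ₂, smul_smul]; ring_nf)
  by_cases hρ0 : ρ = 0
  · -- a nonzero TRANSLATION annihilates the germ
    have hb0 : b ≠ 0 := hbr.resolve_right (not_not.2 hρ0)
    rw [hρ0] at hdrift
    exact eq_zero_of_genReading_translation hu hb0 ht₁ hU hne hdrift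
  by_cases hb0 : b = 0
  · -- a FROZEN instant: tree
    rw [hb0] at hdrift
    exact eq_zero_of_genReading_frozen hu ht₁ hρ0 hU hne hdrift
  -- a TRAVELLING instant `D(u t₁)[b] + ρ ∂ₜu = 0`: eliminate `∂ₜu` from the first reading — what is left
  -- is a scaling reading with its vertex ON the slice, which the kinematic cell kills
  have hV : ∀ x ∈ U, timeDeriv u t₁ x = (-ρ⁻¹) • fderiv ℝ (u t₁) x b := by
    intro x hx
    have h0 := hdrift x hx
    simp only [genReading, zero_smul, add_zero, mul_zero, zero_mul, zero_add] at h0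
    have : ρ • timeDeriv u t₁ x = -(fderiv ℝ (u t₁) x b) := eq_neg_of_add_eq_zero_right h0
    calc timeDeriv u t₁ x = ρ⁻¹ • (ρ • timeDeriv u t₁ x) := by rw [inv_smul_smul₀ hρ0]
      _ = (-ρ⁻¹) • fderiv ℝ (u t₁) x b := by rw [this, smul_neg, neg_smul]
  set c : ℝ := (2 * σ₁ * t₁ + τ₁) * -ρ⁻¹ with hc
  have hon : ∀ x ∈ U, genReading (a₁ + c • b) σ₁ (-(2 * σ₁ * t₁)) u t₁ x = 0 := by
    intro x hx
    have h0 := h₁ x hx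
    rw [genReading_apply, hV x hx, smul_smul, ← hc] at h0
    rw [genReading_apply, show 2 * σ₁ * t₁ + -(2 * σ₁ * t₁) = 0 by ring, zero_smul, add_zero,
      show a₁ + c • b + σ₁ • x = (a₁ + σ₁ • x) + c • b by abel, map_add, map_smul]
    calc fderiv ℝ (u t₁) x (a₁ + σ₁ • x) + c • fderiv ℝ (u t₁) x b + σ₁ • u t₁ x
        = fderiv ℝ (u t₁) x (a₁ + σ₁ • x) + σ₁ • u t₁ x + c • fderiv ℝ (u t₁) x b := by abel
      _ = 0 := h0
  exact eq_zero_of_genReading_onSlice hu ht₁ hσ₁ (by ring) hU hne hon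

/-- **TWO-GENERATOR LAW.** If TWO NON-PROPORTIONAL generators `(a₁, σ₁, τ₁)`, `(a₂, σ₂, τ₂)` of the
parabolic algebra (some `2 × 2` minor of the pair is nonzero) annihilate ONE GERM of ONE slice of `u ∈ A_C`,
then `u ≡ 0` — WHATEVER the vertex positions (past vertices and travelling drifts included): a suitable
combination is a drift `(b, 0, ρ) ≠ 0`; a translation (`ρ = 0`) or a frozen instant (`b = 0`) kills, and a
travelling instant lets one ELIMINATE `∂ₜu` from a scaling reading, leaving a scaling reading with its
vertex ON the slice, which the kinematic cell kills; two drifts combine to a translation. -/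
theorem eq_zero_of_twoGenReadings (hu : IsTypeIAncientMild C u) {a₁ a₂ : E3} {σ₁ σ₂ τ₁ τ₂ t₁ : ℝ}
    (ht₁ : t₁ < 0) {U : Set E3} (hU : IsOpen U) (hne : U.Nonempty)
    (h₁ : ∀ x ∈ U, genReading a₁ σ₁ τ₁ u t₁ x = 0) (h₂ : ∀ x ∈ U, genReading a₂ σ₂ τ₂ u t₁ x = 0)
    (hmin : σ₁ * τ₂ ≠ σ₂ * τ₁ ∨ σ₁ • a₂ ≠ σ₂ • a₁ ∨ τ₁ • a₂ ≠ τ₂ • a₁) :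
    ∀ t < 0, ∀ x, u t x = 0 := by
  by_cases hσ₁ : σ₁ ≠ 0
  · exact eq_zero_of_twoGenReadings_core hu ht₁ hσ₁ hU hne h₁ h₂ hmin
  by_cases hσ₂ : σ₂ ≠ 0
  · refine eq_zero_of_twoGenReadings_core hu ht₁ hσ₂ hU hne h₂ h₁ ?_
    rcases hmin with h | h | h
    · exact Or.inl fun e => h e.symm
    · exact Or.inr (Or.inl fun e => h e.symm)
    · exact Or.inr (Or.inr fun e => h e.symm)
  -- two drifts: `σ₁ = σ₂ = 0`, and `τ₂ g₁ − τ₁ g₂` is a nonzero translation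
  have hσ₁' : σ₁ = 0 := not_not.1 hσ₁
  have hσ₂' : σ₂ = 0 := not_not.1 hσ₂
  have hC : τ₁ • a₂ ≠ τ₂ • a₁ := by
    rcases hmin with h | h | h
    · exact absurd (by rw [hσ₁', hσ₂']; ring) h
    · exact absurd (by rw [hσ₁', hσ₂', zero_smul, zero_smul]) h
    · exact h
  have hb : τ₂ • a₁ + -τ₁ • a₂ ≠ 0 := by
    intro e
    apply hC
    rw [neg_smul, ← sub_eq_add_neg, sub_eq_zero] at e
    exact e.symm
  have htr : ∀ x ∈ U, genReading (τ₂ • a₁ + -τ₁ • a₂) 0 0 u t₁ x = 0 := by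
    intro x hx
    have := genReading_comb τ₂ (-τ₁) a₁ a₂ σ₁ σ₂ τ₁ τ₂ u t₁ x
    rw [h₁ x hx, h₂ x hx, smul_zero, smul_zero, add_zero, hσ₁', hσ₂'] at this
    have e1 : τ₂ * 0 + -τ₁ * 0 = (0 : ℝ) := by ring
    have e2 : τ₂ * τ₁ + -τ₁ * τ₂ = (0 : ℝ) := by ring
    rw [e1, e2] at this
    exact this
  exact eq_zero_of_genReading_translation hu hb ht₁ hU hne htr

/-- **RANK LAW (the finite-model reading of the two-generator law).** At every germ of every slice of a
NONZERO `u ∈ A_C`, the annihilator `{(a, σ, τ) : genReading a σ τ u t₁ ≡ 0 near x₀}` — a linear subspace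
of the 5-dimensional algebra by `genReading_comb` — has dimension `≤ 1`: any two annihilating generators
are linearly dependent. -/
theorem annihilator_rank_le_one (hu : IsTypeIAncientMild C u) (hnz : ∃ t < 0, ∃ x, u t x ≠ 0)
    {t₁ : ℝ} (ht₁ : t₁ < 0) {U : Set E3} (hU : IsOpen U) (hne : U.Nonempty)
    {a₁ a₂ : E3} {σ₁ σ₂ τ₁ τ₂ : ℝ}
    (h₁ : ∀ x ∈ U, genReading a₁ σ₁ τ₁ u t₁ x = 0) (h₂ : ∀ x ∈ U, genReading a₂ σ₂ τ₂ u t₁ x = 0) :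
    ∃ r s : ℝ, (r ≠ 0 ∨ s ≠ 0) ∧ r • a₁ + s • a₂ = 0 ∧ r * σ₁ + s * σ₂ = 0 ∧ r * τ₁ + s * τ₂ = 0 := by
  obtain ⟨t, ht, x, hx⟩ := hnz
  have key : ¬ (σ₁ * τ₂ ≠ σ₂ * τ₁ ∨ σ₁ • a₂ ≠ σ₂ • a₁ ∨ τ₁ • a₂ ≠ τ₂ • a₁) := fun hmin =>
    hx (eq_zero_of_twoGenReadings hu ht₁ hU hne h₁ h₂ hmin t ht x)
  have hA : σ₁ * τ₂ = σ₂ * τ₁ := by by_contra h; exact key (Or.inl h)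
  have hB : σ₁ • a₂ = σ₂ • a₁ := by by_contra h; exact key (Or.inr (Or.inl h))
  have hC : τ₁ • a₂ = τ₂ • a₁ := by by_contra h; exact key (Or.inr (Or.inr h))
  by_cases hσ : σ₁ ≠ 0 ∨ σ₂ ≠ 0
  · refine ⟨σ₂, -σ₁, ?_, ?_, by ring, by linear_combination -hA⟩
    · rcases hσ with h | h
      · exact Or.inr (neg_ne_zero.2 h)
      · exact Or.inl h
    · rw [neg_smul, ← sub_eq_add_neg, hB, sub_self]
  have hσ₁ : σ₁ = 0 := by by_contra h; exact hσ (Or.inl h)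
  have hσ₂ : σ₂ = 0 := by by_contra h; exact hσ (Or.inr h)
  by_cases hτ : τ₁ ≠ 0 ∨ τ₂ ≠ 0
  · refine ⟨τ₂, -τ₁, ?_, ?_, by rw [hσ₁, hσ₂]; ring, by ring⟩
    · rcases hτ with h | h
      · exact Or.inr (neg_ne_zero.2 h)
      · exact Or.inl h
    · rw [neg_smul, ← sub_eq_add_neg, hC, sub_self]
  have hτ₁ : τ₁ = 0 := by by_contra h; exact hτ (Or.inl h)
  have hτ₂ : τ₂ = 0 := by by_contra h; exact hτ (Or.inr h)
  by_cases ha₁ : a₁ = 0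
  · exact ⟨1, 0, Or.inl one_ne_zero, by rw [ha₁, smul_zero, zero_smul, add_zero],
      by rw [hσ₁, hσ₂]; ring, by rw [hτ₁, hτ₂]; ring⟩
  · exfalso
    refine hx (eq_zero_of_genReading_translation hu ha₁ ht₁ hU hne (fun y hy => ?_) t ht x)
    have := h₁ y hy
    rwa [hσ₁, hτ₁] at this

/-- **THE ANNIHILATOR LIES IN THE OPEN CONE.** If a NONZERO generator annihilates a germ of a slice of a
NONZERO `u ∈ A_C`, it is a scaling with its vertex in the PAST of the slice or a TRAVELLING drift
(`σ = 0`, `τ ≠ 0`, `a ≠ 0`) — the two typed-open cells; every other cell is decided (here or in the tree). -/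
theorem annihilator_in_open_cone (hu : IsTypeIAncientMild C u) (hnz : ∃ t < 0, ∃ x, u t x ≠ 0)
    {t₁ : ℝ} (ht₁ : t₁ < 0) {U : Set E3} (hU : IsOpen U) (hne : U.Nonempty) {a : E3} {σ τ : ℝ}
    (hg : a ≠ 0 ∨ σ ≠ 0 ∨ τ ≠ 0) (h : ∀ x ∈ U, genReading a σ τ u t₁ x = 0) :
    (σ ≠ 0 ∧ 0 < σ * (2 * σ * t₁ + τ)) ∨ (σ = 0 ∧ τ ≠ 0 ∧ a ≠ 0) := by
  obtain ⟨t, ht, x, hx⟩ := hnz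
  rcases genTable σ τ t₁ with ⟨hσ, hlt⟩ | ⟨hσ, hon⟩ | ⟨hσ, hgt⟩ | ⟨hσ, hτ⟩ | ⟨hσ, hτ⟩
  · exact absurd (eq_zero_of_genReading_future hu ht₁ hσ hlt hU hne h t ht x) hx
  · exact absurd (eq_zero_of_genReading_onSlice hu ht₁ hσ hon hU hne h t ht x) hx
  · exact Or.inl ⟨hσ, hgt⟩
  · refine Or.inr ⟨hσ, hτ, fun ha => hx ?_⟩
    subst hσ; subst ha
    exact eq_zero_of_genReading_frozen hu ht₁ hτ hU hne h t ht x
  · subst hσ; subst hτ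
    rcases hg with ha | h0 | h0
    · exact absurd (eq_zero_of_genReading_translation hu ha ht₁ hU hne h t ht x) hx
    · exact absurd rfl h0
    · exact absurd rfl h0

/-! ## G. The cells the profile dictionary does NOT decide (typed OPEN): expander slice, travelling instant -/

/-- **Profile dictionary (vertex in the PAST of the slice).** If the normalised scaling reading vanishes
on the slice with `κ > 0` (vertex time `θ = t₁ − κ/2 < t₁`), the slice is a bounded FORWARD
(expander) profile `IsForwardProfile 1 κ⁻¹` — and bounded forward profiles EXIST non-trivially
(Cannone–Planchon, Jia–Šverák 2014: the Literature docstring of `IsForwardProfile`), so NO profile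
Liouville theorem decides this cell; it is typed OPEN below (`Row_A2gnE`). -/
theorem forwardProfile_of_scalingSlice (hu : IsTypeIAncientMild C u) {t₁ : ℝ} (ht₁ : t₁ < 0)
    {κ : ℝ} (hκ : 0 < κ)
    (h : ∀ y, fderiv ℝ (u t₁) y y + u t₁ y + κ • timeDeriv u t₁ y = 0) :
    ∃ P : E3 → ℝ, IsForwardProfile 1 κ⁻¹ (u t₁) P := by
  obtain ⟨p, hp⟩ := hu.exists_isClassicalNSSolutionOn_Ioo (t₀ := 2 * t₁) (by linarith)
  have hmem : t₁ ∈ Ioo (2 * t₁) 0 := ⟨by linarith, ht₁⟩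
  refine ⟨p t₁, ?_, ?_, ?_, hu.isDivFree ht₁⟩
  · exact (hu.contDiff_slice ht₁).of_le (by norm_cast)
  · have hps : ContDiff ℝ (⊤ : ℕ∞) (p t₁) :=
      hp.smooth_pressure.comp_contDiff (contDiff_prodMk_right t₁)
        fun x => mk_mem_prod hmem (mem_univ x)
    exact hps.of_le (by norm_cast)
  · intro y
    have hmom := hp.momentum t₁ hmem y
    have htd : timeDerivWithin (Ioo (2 * t₁) 0) u t₁ y = timeDeriv u t₁ y := by
      simp only [timeDerivWithin_apply, timeDeriv_apply]
      exact derivWithin_of_isOpen isOpen_Ioo hmem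
    rw [htd] at hmom
    have hκ0 : κ ≠ 0 := hκ.ne'
    have hd : timeDeriv u t₁ y = (-κ⁻¹) • (fderiv ℝ (u t₁) y y + u t₁ y) := by
      have h1 : κ • timeDeriv u t₁ y = -(fderiv ℝ (u t₁) y y + u t₁ y) := by
        rw [eq_neg_iff_add_eq_zero, add_comm]; exact h y
      calc timeDeriv u t₁ y = κ⁻¹ • (κ • timeDeriv u t₁ y) := by rw [inv_smul_smul₀ hκ0]
        _ = (-κ⁻¹) • (fderiv ℝ (u t₁) y y + u t₁ y) := by rw [h1, smul_neg, neg_smul]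
    rw [hd] at hmom
    simp only [Pi.zero_apply, add_zero, one_smul] at hmom
    rw [← sub_eq_zero] at hmom
    rw [← hmom]
    simp only [smul_add, neg_smul, one_smul]
    abel

/-- **Profile dictionary (`σ = 0`, `τ ≠ 0`): a frozen or travelling instant.** If
`D(u t₁)[a] + τ ∂ₜu(t₁, ·) = 0` on the slice, then with the classical pressure `P` of the class the
slice solves the TRAVELLING-WAVE profile system with velocity `c = τ⁻¹a`
(`ΔU − (U·∇)U − ∇P + DU[c] = 0`; steady Navier–Stokes for `a = 0`).  Bounded steady / travelling
profiles have NO Liouville theorem in the tree (the bounded steady Liouville problem), so this cell is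
typed OPEN below (`Row_A2gnT`); its SLAB version (a rigid co-motion) is tree-decided
(`stub_rigidComotionVanishing`). -/
theorem travellingProfile_of_driftSlice (hu : IsTypeIAncientMild C u) {t₁ : ℝ} (ht₁ : t₁ < 0)
    {a : E3} {τ : ℝ} (hτ : τ ≠ 0) (h : ∀ y, fderiv ℝ (u t₁) y a + τ • timeDeriv u t₁ y = 0) :
    ∃ P : E3 → ℝ, ContDiff ℝ 1 P ∧
      ∀ y, Laplacian.laplacian (u t₁) y - convect (u t₁) (u t₁) y - gradient P y +
        fderiv ℝ (u t₁) y (τ⁻¹ • a) = 0 := by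
  obtain ⟨p, hp⟩ := hu.exists_isClassicalNSSolutionOn_Ioo (t₀ := 2 * t₁) (by linarith)
  have hmem : t₁ ∈ Ioo (2 * t₁) 0 := ⟨by linarith, ht₁⟩
  refine ⟨p t₁, ?_, fun y => ?_⟩
  · have hps : ContDiff ℝ (⊤ : ℕ∞) (p t₁) :=
      hp.smooth_pressure.comp_contDiff (contDiff_prodMk_right t₁)
        fun x => mk_mem_prod hmem (mem_univ x)
    exact hps.of_le (by norm_cast)
  · have hmom := hp.momentum t₁ hmem y
    have htd : timeDerivWithin (Ioo (2 * t₁) 0) u t₁ y = timeDeriv u t₁ y := by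
      simp only [timeDerivWithin_apply, timeDeriv_apply]
      exact derivWithin_of_isOpen isOpen_Ioo hmem
    rw [htd] at hmom
    have hd : timeDeriv u t₁ y = -(fderiv ℝ (u t₁) y (τ⁻¹ • a)) := by
      have h1 : τ • timeDeriv u t₁ y = -(fderiv ℝ (u t₁) y a) := by
        rw [eq_neg_iff_add_eq_zero, add_comm]; exact h y
      calc timeDeriv u t₁ y = τ⁻¹ • (τ • timeDeriv u t₁ y) := by rw [inv_smul_smul₀ hτ]
        _ = -(fderiv ℝ (u t₁) y (τ⁻¹ • a)) := by rw [h1, smul_neg, map_smul]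
    rw [hd] at hmom
    simp only [Pi.zero_apply, add_zero, one_smul] at hmom
    rw [← sub_eq_zero] at hmom
    calc Laplacian.laplacian (u t₁) y - convect (u t₁) (u t₁) y - gradient (p t₁) y +
          fderiv ℝ (u t₁) y (τ⁻¹ • a)
        = -(-(fderiv ℝ (u t₁) y (τ⁻¹ • a)) + convect (u t₁) (u t₁) y -
            (Laplacian.laplacian (u t₁) y - gradient (p t₁) y)) := by abel
      _ = 0 := by rw [hmom, neg_zero]

end Summit.NavierStokesRegularity.NavierStokesRegularity.Theorems.ScenarioCensus.GeneratorMeter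

end
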